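import Mathlib.Analysis.Matrix.Spectrum
import Mathlib.Analysis.Analytic.Polynomial
import Mathlib.Analysis.Calculus.Deriv.Polynomial
import Mathlib.Analysis.Complex.Basic
import Mathlib.LinearAlgebra.Matrix.MvPolynomial
import Mathlib.Algebra.Polynomial.FieldDivision
import HarnessLib

/-!
# Hermitean pencils `A(ξ) = Σⱼ ξⱼ Aⱼ`: the real characteristic polynomial and its roots

For constant hermitean `N × N` matrices `A₁, …, A_d` the pencil `A(ξ) = Σⱼ ξⱼ Aⱼ`,
`ξ ∈ ℝᵈ`, is hermitean, so its characteristic polynomial has real coefficients and real roots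
(the eigenvalues). This file packages the elementary facts used in the perturbation theory of
the eigenvalues of `A(ξ)` ([Kato1966, Ch. II §1.1, §5.1]; the setting of
[BrennerThomeeWahlbin1975, Ch. 5 §1 Lemma 1.1]): the real characteristic polynomial
`realCharpoly` (monic of degree `N`, splitting over `ℝ`), the fact that its coefficients — hence
the values of all its `z`-derivatives — are real-analytic (indeed polynomial) functions of `ξ`,
and the lower semicontinuity of the set of roots ("near a root of `p_{ξ⁰}` there is a root of
`p_ξ` for `ξ` near `ξ⁰`").

## Contents

* `pencil A ξ = Σⱼ ξⱼ Aⱼ` on `ξ ∈ EuclideanSpace ℝ (Fin d)` (the argument of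
  `Literature.Analysis.Fourier.hyperbolicSymbol`), `isHermitian_pencil`;
* `realCharpoly hA ξ = ∏ᵢ (X - λᵢ(ξ))`, `map_realCharpoly` (its image in `ℂ[X]` is the
  characteristic polynomial), `coeff_realCharpoly_eq_re`;
* `analyticAt_charpoly_coeff`, `analyticAt_realCharpoly_coeff` — coefficients are analytic in `ξ`;
* `evalIterDeriv hA k (ξ, z) = (p_ξ)^{(k)}(z)`, `analyticAt_evalIterDeriv`,
  `hasDerivAt_evalIterDeriv`;
* `norm_eval_realCharpoly_eq_prod`, `exists_root_near_of_isRoot` — lower semicontinuity of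
  roots.

## References

* [Kato1966] T. Kato, *Perturbation Theory for Linear Operators* (Springer 1966), Ch. II
  §1.1 (the characteristic equation `det(T(ϰ) - ζ) = 0` of a holomorphic family, (1.3)),
  §5.1 and §5.7 Thm 5.14 (continuity of the unordered `N`-tuple of eigenvalues).
* [BrennerThomeeWahlbin1975] P. Brenner, V. Thomée, L. B. Wahlbin, LNM 434 (1975), Ch. 5 §1.
-/

noncomputable section

open Polynomial Filter
open scoped Topology

namespace Literature.Analysis.Matrix

variable {d N : ℕ}

/-! ### The pencil -/

/-- **The hermitean pencil** `A(ξ) = Σⱼ ξⱼ Aⱼ` of `d` constant `N × N` matrices, as a function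
of `ξ ∈ ℝᵈ = EuclideanSpace ℝ (Fin d)` (the expression inside
`Literature.Analysis.Fourier.hyperbolicSymbol`). [cite: BrennerThomeeWahlbin1975, Ch. 5 §1 Lemma 1.1] -/
def pencil (A : Fin d → Matrix (Fin N) (Fin N) ℂ) (ξ : EuclideanSpace ℝ (Fin d)) :
    Matrix (Fin N) (Fin N) ℂ :=
  ∑ j, ((ξ j : ℝ) : ℂ) • A j

/-- Unfolding `pencil`. [folklore] -/
theorem pencil_apply (A : Fin d → Matrix (Fin N) (Fin N) ℂ) (ξ : EuclideanSpace ℝ (Fin d)) :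
    pencil A ξ = ∑ j, ((ξ j : ℝ) : ℂ) • A j := rfl

/-- Entries of the pencil: `A(ξ)ᵢₖ = Σⱼ ξⱼ (Aⱼ)ᵢₖ`. [folklore] -/
theorem pencil_apply_apply (A : Fin d → Matrix (Fin N) (Fin N) ℂ) (ξ : EuclideanSpace ℝ (Fin d))
    (i k : Fin N) : pencil A ξ i k = ∑ j, ((ξ j : ℝ) : ℂ) * A j i k := by
  simp [pencil, Matrix.sum_apply]

/-- A pencil of hermitean matrices is hermitean for real `ξ`. [folklore] -/
theorem isHermitian_pencil {A : Fin d → Matrix (Fin N) (Fin N) ℂ} (hA : ∀ j, (A j).IsHermitian)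
    (ξ : EuclideanSpace ℝ (Fin d)) : (pencil A ξ).IsHermitian := by
  unfold pencil
  induction (Finset.univ : Finset (Fin d)) using Finset.induction_on with
  | empty => simp
  | insert j s hj ih =>
      rw [Finset.sum_insert hj]
      exact ((hA j).smul (Complex.conj_ofReal _)).add ih

/-- The pencil is real-linear, in particular continuous, in `ξ`, entrywise. [folklore] -/
theorem pencil_entry_eq_clm (A : Fin d → Matrix (Fin N) (Fin N) ℂ) (i k : Fin N) :
    (fun ξ : EuclideanSpace ℝ (Fin d) => pencil A ξ i k) =
      ⇑(∑ j, (A j i k) • (Complex.ofRealCLM.comp (EuclideanSpace.proj (𝕜 := ℝ) j))) := by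
  funext ξ
  simp [pencil_apply_apply, mul_comm]

/-- Entries of the pencil are real-analytic functions of `ξ`. [folklore] -/
theorem analyticAt_pencil_entry (A : Fin d → Matrix (Fin N) (Fin N) ℂ) (i k : Fin N)
    (ξ : EuclideanSpace ℝ (Fin d)) : AnalyticAt ℝ (fun ξ => pencil A ξ i k) ξ := by
  rw [pencil_entry_eq_clm]
  exact ContinuousLinearMap.analyticAt _ ξ

/-! ### The real characteristic polynomial -/

section realCharpoly

variable {A : Fin d → Matrix (Fin N) (Fin N) ℂ} (hA : ∀ j, (A j).IsHermitian)

/-- **The real characteristic polynomial** `p_ξ = ∏ᵢ (X - λᵢ(ξ)) ∈ ℝ[X]` of the hermitean pencil,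
`λᵢ(ξ)` its (real) eigenvalues counted with multiplicity. [cite: Kato1966, Ch. II §1.1 (1.3)] -/
def realCharpoly (ξ : EuclideanSpace ℝ (Fin d)) : ℝ[X] :=
  ∏ i, (X - C ((isHermitian_pencil hA ξ).eigenvalues i))

/-- `p_ξ` mapped to `ℂ[X]` is the characteristic polynomial of `A(ξ)`.
[cite: Kato1966, Ch. II §1.1 (1.3)] -/
theorem map_realCharpoly (ξ : EuclideanSpace ℝ (Fin d)) :
    (realCharpoly hA ξ).map (algebraMap ℝ ℂ) = (pencil A ξ).charpoly := by
  rw [(isHermitian_pencil hA ξ).charpoly_eq, realCharpoly, Polynomial.map_prod]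
  simp

/-- `p_ξ` is monic. [folklore] -/
theorem monic_realCharpoly (ξ : EuclideanSpace ℝ (Fin d)) : (realCharpoly hA ξ).Monic :=
  monic_prod_of_monic _ _ fun _ _ => monic_X_sub_C _

/-- `p_ξ ≠ 0`. [folklore] -/
theorem realCharpoly_ne_zero (ξ : EuclideanSpace ℝ (Fin d)) : realCharpoly hA ξ ≠ 0 :=
  (monic_realCharpoly hA ξ).ne_zero

/-- `deg p_ξ = N`. [folklore] -/
theorem natDegree_realCharpoly (ξ : EuclideanSpace ℝ (Fin d)) :
    (realCharpoly hA ξ).natDegree = N := by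
  rw [realCharpoly, natDegree_prod_of_monic _ _ fun _ _ => monic_X_sub_C _]
  simp

/-- The roots of `p_ξ` are the eigenvalues of `A(ξ)` (with multiplicity). [folklore] -/
theorem roots_realCharpoly (ξ : EuclideanSpace ℝ (Fin d)) :
    (realCharpoly hA ξ).roots =
      Multiset.map (isHermitian_pencil hA ξ).eigenvalues Finset.univ.val := by
  rw [realCharpoly, Polynomial.roots_prod]
  · simp
  · simp [Finset.prod_ne_zero_iff, X_sub_C_ne_zero]

/-- `p_ξ` has exactly `N` roots counted with multiplicity. [folklore] -/
theorem card_roots_realCharpoly (ξ : EuclideanSpace ℝ (Fin d)) :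
    Multiset.card (realCharpoly hA ξ).roots = N := by
  simp [roots_realCharpoly]

/-- `p_ξ(z) = ∏ᵢ (z - λᵢ(ξ))`. [folklore] -/
theorem eval_realCharpoly (ξ : EuclideanSpace ℝ (Fin d)) (z : ℝ) :
    (realCharpoly hA ξ).eval z = ∏ i, (z - (isHermitian_pencil hA ξ).eigenvalues i) := by
  simp [realCharpoly, eval_prod]

/-- The coefficients of `p_ξ` are the (real) coefficients of the characteristic polynomial.
[folklore] -/
theorem coeff_realCharpoly_eq_re (ξ : EuclideanSpace ℝ (Fin d)) (m : ℕ) :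
    (realCharpoly hA ξ).coeff m = ((pencil A ξ).charpoly.coeff m).re := by
  rw [← map_realCharpoly hA ξ, coeff_map]
  simp

end realCharpoly

/-! ### Analyticity of the coefficients in `ξ` -/

/-- The coefficients of the characteristic polynomial of a matrix are polynomials in its entries:
`M.charpoly.coeff m` is the evaluation at the entries of `M` of the corresponding coefficient of
the characteristic polynomial of the generic matrix. [folklore] -/
theorem charpoly_coeff_eq_eval_mvPolynomialX (M : Matrix (Fin N) (Fin N) ℂ) (m : ℕ) :
    M.charpoly.coeff m = MvPolynomial.aeval (fun p : Fin N × Fin N => M p.1 p.2)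
      ((Matrix.mvPolynomialX (Fin N) (Fin N) ℂ).charpoly.coeff m) := by
  have key : (Matrix.mvPolynomialX (Fin N) (Fin N) ℂ).map
      ⇑((MvPolynomial.aeval fun p : Fin N × Fin N => M p.1 p.2).toRingHom) = M := by
    ext i j; simp
  conv_lhs => rw [← key]
  rw [Matrix.charpoly_map, coeff_map]
  rfl

/-- **The coefficients of `det(XI - A(ξ))` are real-analytic (polynomial) functions of `ξ`.**
[cite: Kato1966, Ch. II §1.1 (1.3)] -/
theorem analyticAt_charpoly_coeff (A : Fin d → Matrix (Fin N) (Fin N) ℂ) (m : ℕ)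
    (ξ : EuclideanSpace ℝ (Fin d)) :
    AnalyticAt ℝ (fun ξ => (pencil A ξ).charpoly.coeff m) ξ := by
  simp_rw [charpoly_coeff_eq_eval_mvPolynomialX]
  have h := AnalyticAt.aeval_mvPolynomial (𝕜 := ℝ) (A := ℂ) (B := ℂ)
    (f := fun (ξ : EuclideanSpace ℝ (Fin d)) (p : Fin N × Fin N) => pencil A ξ p.1 p.2) (z := ξ)
    (fun p => analyticAt_pencil_entry A p.1 p.2 ξ)
    ((Matrix.mvPolynomialX (Fin N) (Fin N) ℂ).charpoly.coeff m)
  exact h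

/-- The coefficients of the real characteristic polynomial are real-analytic in `ξ`.
[cite: Kato1966, Ch. II §1.1 (1.3)] -/
theorem analyticAt_realCharpoly_coeff {A : Fin d → Matrix (Fin N) (Fin N) ℂ}
    (hA : ∀ j, (A j).IsHermitian) (m : ℕ) (ξ : EuclideanSpace ℝ (Fin d)) :
    AnalyticAt ℝ (fun ξ => (realCharpoly hA ξ).coeff m) ξ := by
  simp_rw [coeff_realCharpoly_eq_re]
  exact (Complex.reCLM.analyticAt _).comp (analyticAt_charpoly_coeff A m ξ)

/-! ### Values of the `z`-derivatives of `p_ξ` as analytic functions of `(ξ, z)` -/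

section evalIterDeriv

variable {A : Fin d → Matrix (Fin N) (Fin N) ℂ} (hA : ∀ j, (A j).IsHermitian)

/-- `(ξ, z) ↦ p_ξ^{(k)}(z)`, the value at `z` of the `k`-th derivative of the real
characteristic polynomial of `A(ξ)`. [cite: Kato1966, Ch. II §1.1 (1.3)] -/
def evalIterDeriv (k : ℕ) (u : EuclideanSpace ℝ (Fin d) × ℝ) : ℝ :=
  (derivative^[k] (realCharpoly hA u.1)).eval u.2

/-- Unfolding `evalIterDeriv`. [folklore] -/
theorem evalIterDeriv_apply (k : ℕ) (ξ : EuclideanSpace ℝ (Fin d)) (z : ℝ) :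
    evalIterDeriv hA k (ξ, z) = (derivative^[k] (realCharpoly hA ξ)).eval z := rfl

/-- `p_ξ^{(k)}(z)` as an explicit finite sum of monomials in `z` with coefficients the
coefficients of `p_ξ`. [folklore] -/
theorem evalIterDeriv_eq_sum (k : ℕ) (u : EuclideanSpace ℝ (Fin d) × ℝ) :
    evalIterDeriv hA k u = ∑ m ∈ Finset.range (N + 1),
      ((m + k).descFactorial k : ℝ) * (realCharpoly hA u.1).coeff (m + k) * u.2 ^ m := by
  unfold evalIterDeriv
  rw [eval_eq_sum_range' (n := N + 1)]
  · refine Finset.sum_congr rfl fun m _ => ?_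
    rw [coeff_iterate_derivative, nsmul_eq_mul]
  · calc (derivative^[k] (realCharpoly hA u.1)).natDegree
        ≤ (realCharpoly hA u.1).natDegree - k := natDegree_iterate_derivative _ _
      _ ≤ N := by rw [natDegree_realCharpoly]; exact Nat.sub_le _ _
      _ < N + 1 := N.lt_succ_self

/-- **`(ξ, z) ↦ p_ξ^{(k)}(z)` is real-analytic** (a polynomial in `z` whose coefficients are
polynomials in `ξ`). [cite: Kato1966, Ch. II §1.1 (1.3)] -/
theorem analyticAt_evalIterDeriv (k : ℕ) (u : EuclideanSpace ℝ (Fin d) × ℝ) :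
    AnalyticAt ℝ (evalIterDeriv hA k) u := by
  have h : evalIterDeriv hA k = fun u => ∑ m ∈ Finset.range (N + 1),
      ((m + k).descFactorial k : ℝ) * (realCharpoly hA u.1).coeff (m + k) * u.2 ^ m :=
    funext (evalIterDeriv_eq_sum hA k)
  rw [h]
  refine Finset.analyticAt_fun_sum _ fun m _ => ?_
  have h1 : AnalyticAt ℝ
      (fun u : EuclideanSpace ℝ (Fin d) × ℝ => (realCharpoly hA u.1).coeff (m + k)) u :=
    (analyticAt_realCharpoly_coeff hA (m + k) u.1).comp analyticAt_fst
  have h2 : AnalyticAt ℝ (fun u : EuclideanSpace ℝ (Fin d) × ℝ => u.2 ^ m) u :=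
    analyticAt_snd.pow m
  exact (analyticAt_const.mul h1).mul h2

/-- `(ξ, z) ↦ p_ξ^{(k)}(z)` is `C^ω`. [folklore] -/
theorem contDiffAt_evalIterDeriv (k : ℕ) (u : EuclideanSpace ℝ (Fin d) × ℝ) {n : WithTop ℕ∞} :
    ContDiffAt ℝ n (evalIterDeriv hA k) u :=
  (analyticAt_evalIterDeriv hA k u).contDiffAt

/-- `(ξ, z) ↦ p_ξ^{(k)}(z)` is continuous. [folklore] -/
theorem continuous_evalIterDeriv (k : ℕ) : Continuous (evalIterDeriv hA k) :=
  continuous_iff_continuousAt.2 fun u => (analyticAt_evalIterDeriv hA k u).continuousAt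

/-- `∂/∂z p_ξ^{(k)}(z) = p_ξ^{(k+1)}(z)`. [folklore] -/
theorem hasDerivAt_evalIterDeriv (k : ℕ) (ξ : EuclideanSpace ℝ (Fin d)) (z : ℝ) :
    HasDerivAt (fun w => evalIterDeriv hA k (ξ, w)) (evalIterDeriv hA (k + 1) (ξ, z)) z := by
  have h := (derivative^[k] (realCharpoly hA ξ)).hasDerivAt z
  rwa [← Function.iterate_succ_apply' derivative k] at h

/-- The partial derivative in `z` as a value of the Fréchet derivative:
`D(p^{(k)})(ξ, z) ∘ inr = (t ↦ t · p_ξ^{(k+1)}(z))`. [folklore] -/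
theorem fderiv_evalIterDeriv_comp_inr (k : ℕ) (ξ : EuclideanSpace ℝ (Fin d)) (z : ℝ) :
    (fderiv ℝ (evalIterDeriv hA k) (ξ, z)).comp (ContinuousLinearMap.inr ℝ _ ℝ) =
      evalIterDeriv hA (k + 1) (ξ, z) • ContinuousLinearMap.id ℝ ℝ := by
  have hd : HasFDerivAt (evalIterDeriv hA k) (fderiv ℝ (evalIterDeriv hA k) (ξ, z)) (ξ, z) :=
    ((analyticAt_evalIterDeriv hA k (ξ, z)).differentiableAt).hasFDerivAt
  have hc : HasFDerivAt (fun w : ℝ => evalIterDeriv hA k (ξ, w))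
      ((fderiv ℝ (evalIterDeriv hA k) (ξ, z)).comp (ContinuousLinearMap.inr ℝ _ ℝ)) z :=
    hd.comp z (hasFDerivAt_prodMk_right ξ z)
  have h1 := hc.hasDerivAt
  have h2 := (hasDerivAt_evalIterDeriv hA k ξ z)
  have heq : ((fderiv ℝ (evalIterDeriv hA k) (ξ, z)).comp (ContinuousLinearMap.inr ℝ _ ℝ)) 1 =
      evalIterDeriv hA (k + 1) (ξ, z) := h1.unique h2
  ext
  simpa using heq

end evalIterDeriv

/-! ### Roots: multiplicities and lower semicontinuity -/

section roots

variable {A : Fin d → Matrix (Fin N) (Fin N) ℂ} (hA : ∀ j, (A j).IsHermitian)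

/-- `|p_ξ(z)| = ∏ᵢ |z - λᵢ(ξ)|`. [folklore] -/
theorem abs_eval_realCharpoly (ξ : EuclideanSpace ℝ (Fin d)) (z : ℝ) :
    |(realCharpoly hA ξ).eval z| = ∏ i, |z - (isHermitian_pencil hA ξ).eigenvalues i| := by
  rw [eval_realCharpoly, Finset.abs_prod]

/-- If all eigenvalues of `A(ξ)` are at distance `≥ ε` from `z` then `|p_ξ(z)| ≥ ε^N`.
[folklore] -/
theorem pow_le_abs_eval_realCharpoly {ξ : EuclideanSpace ℝ (Fin d)} {z ε : ℝ} (hε : 0 ≤ ε)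
    (h : ∀ i, ε ≤ |z - (isHermitian_pencil hA ξ).eigenvalues i|) :
    ε ^ N ≤ |(realCharpoly hA ξ).eval z| := by
  rw [abs_eval_realCharpoly]
  calc ε ^ N = ∏ _i : Fin N, ε := by simp
    _ ≤ ∏ i, |z - (isHermitian_pencil hA ξ).eigenvalues i| :=
        Finset.prod_le_prod (fun _ _ => hε) fun i _ => h i

/-- `z` is a root of `p_ξ` iff it is an eigenvalue of `A(ξ)`. [folklore] -/
theorem isRoot_realCharpoly_iff (ξ : EuclideanSpace ℝ (Fin d)) (z : ℝ) :
    (realCharpoly hA ξ).IsRoot z ↔ ∃ i, (isHermitian_pencil hA ξ).eigenvalues i = z := by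
  rw [← mem_roots (realCharpoly_ne_zero hA ξ), roots_realCharpoly]
  simp

/-- **Lower semicontinuity of the roots.** If `μ` is a root of `p_{ξ⁰}` then for every `ε > 0`,
for all `ξ` near `ξ⁰` the polynomial `p_ξ` has a root within `ε` of `μ` (since
`|p_ξ(μ)| ≥ dist(μ, roots of p_ξ)^N` and `p_ξ(μ) → p_{ξ⁰}(μ) = 0`).
[cite: Kato1966, Ch. II §5.1, §5.7 Thm 5.14] -/
theorem eventually_exists_root_near {ξ₀ : EuclideanSpace ℝ (Fin d)} {μ : ℝ}
    (hμ : (realCharpoly hA ξ₀).IsRoot μ) {ε : ℝ} (hε : 0 < ε) :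
    ∀ᶠ ξ in 𝓝 ξ₀, ∃ w, (realCharpoly hA ξ).IsRoot w ∧ |w - μ| < ε := by
  -- `ξ ↦ p_ξ(μ)` is continuous and vanishes at `ξ₀`
  have hcont : Continuous fun ξ : EuclideanSpace ℝ (Fin d) => evalIterDeriv hA 0 (ξ, μ) :=
    (continuous_evalIterDeriv hA 0).comp (continuous_id.prodMk continuous_const)
  have h0 : evalIterDeriv hA 0 (ξ₀, μ) = 0 := hμ
  have hev : ∀ᶠ ξ in 𝓝 ξ₀, |evalIterDeriv hA 0 (ξ, μ)| < ε ^ N := by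
    have := hcont.continuousAt (x := ξ₀)
    rw [ContinuousAt, h0] at this
    exact (this.abs.eventually (gt_mem_nhds (by simpa using pow_pos hε N)))
  filter_upwards [hev] with ξ hξ
  by_contra hcon
  push Not at hcon
  have hfar : ∀ i, ε ≤ |μ - (isHermitian_pencil hA ξ).eigenvalues i| := fun i => by
    have hi := hcon ((isHermitian_pencil hA ξ).eigenvalues i)
      ((isRoot_realCharpoly_iff hA ξ _).2 ⟨i, rfl⟩)
    rwa [abs_sub_comm] at hi
  have := pow_le_abs_eval_realCharpoly hA hε.le hfar
  exact absurd (lt_of_le_of_lt this hξ) (lt_irrefl _)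

/-- **Multiplicity and derivatives** (characteristic zero): if `μ` is a root of `p_ξ` of
multiplicity exactly `r`, then `p_ξ^{(r-1)}(μ) = 0` (for `r ≥ 1`) and `p_ξ^{(r)}(μ) ≠ 0`.
[folklore] -/
theorem evalIterDeriv_rootMultiplicity_ne_zero (ξ : EuclideanSpace ℝ (Fin d)) (μ : ℝ) :
    evalIterDeriv hA ((realCharpoly hA ξ).rootMultiplicity μ) (ξ, μ) ≠ 0 := by
  set r := (realCharpoly hA ξ).rootMultiplicity μ with hr
  have h := (lt_rootMultiplicity_iff_isRoot_iterate_derivative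
    (realCharpoly_ne_zero hA ξ) (t := μ) (n := r)).not.1 (lt_irrefl r)
  push Not at h
  obtain ⟨m, hmr, hm⟩ := h
  rcases hmr.lt_or_eq with hlt | rfl
  · exact absurd (isRoot_iterate_derivative_of_lt_rootMultiplicity hlt) hm
  · exact hm

/-- If `m < mult_μ(p_ξ)` then `p_ξ^{(m)}(μ) = 0`. [folklore] -/
theorem evalIterDeriv_eq_zero_of_lt_rootMultiplicity {ξ : EuclideanSpace ℝ (Fin d)} {μ : ℝ}
    {m : ℕ} (hm : m < (realCharpoly hA ξ).rootMultiplicity μ) : evalIterDeriv hA m (ξ, μ) = 0 :=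
  isRoot_iterate_derivative_of_lt_rootMultiplicity hm

/-- Conversely, if `p_ξ^{(m)}(w) ≠ 0` then `mult_w(p_ξ) ≤ m`. [folklore] -/
theorem rootMultiplicity_le_of_evalIterDeriv_ne_zero {ξ : EuclideanSpace ℝ (Fin d)} {w : ℝ}
    {m : ℕ} (hm : evalIterDeriv hA m (ξ, w) ≠ 0) : (realCharpoly hA ξ).rootMultiplicity w ≤ m := by
  by_contra h
  exact hm (evalIterDeriv_eq_zero_of_lt_rootMultiplicity hA (not_le.1 h))

end roots

end Literature.Analysis.Matrix

end
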